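import Summits.ValiantsHypothesis.ValiantsHypothesis.Theorems.BarrierLeverAnchoredDoorHitsLowerPairsCrossed

/-!
# Support item `AnchoredDoorHitsLowerPairs` (stmt-ValiantsHypothesis-22510), line `anchored-peeling`:
# the SCALAR crossed member (h² + 2h parameters) and CONJECTURE TXˢ as a typed stub

Helper file (`--supports stmt-ValiantsHypothesis-22510`; cell valiant-natproofs, rung V4, 𝒟-side door (c); registered line
`Cruxes/AnchoredDoorHitsLowerPairs/Lines/anchored_peeling.lean` v10; prover seat val-np-p1 gen 18). Bookkeeping `def`s (`SParam`, `scalarMap`,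
`scalarWitness`, `scalarDet`), two stub texts (OFFERED under D-0145, NOT asserted) and the landed transfers. Closes NO item.

THE MEMBER (memo HOME/val-np-p1/g18/DTS-MEMO-valnp1-g18.md §12). Specialise the crossed member 𝔛 (p604838) further: `π_{cb} := π_c`, `μ_{ad} := μ_a`
(the weight of a tail depends only on the OPPOSITE endpoint of its anchor, not on the tail vertex):
`𝔛ˢ = ∏_{a,c} (1 + θ_{ac} x_a y_c ∏_{b≠a}(1 + π_c x_b) ∏_{d≠c}(1 + μ_a y_d)) = exp(Σ_{a,c} θ_{ac} x_a y_c e^{π_c σ_X + μ_a σ_Y})`, `σ_X = Σ x_b`,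
`σ_Y = Σ y_d`. Its layout entries are EXPLICIT:
`M[U,V] = Σ_{A⊆U, T⊆V, |A|=|T|} perm(θ[A,T]) · (Σ_{c∈T} π_c)^{|U|−|A|} · (Σ_{a∈A} μ_a)^{|V|−|T|}`.
* `scalarDet h r u w` — that minor (as `MvPolynomial.rename scalarMap` of nothing: defined directly from `scalarWitness`);
  `rename_crossedDet : rename scalarMap (crossedDet h r u w) = scalarDet h r u w`; TRANSFERS `crossedDet_ne_zero_of_scalarDet_ne_zero`,
  `symbolicDet_ne_zero_of_scalarDet_ne_zero` (every `s ≥ 1`).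
* `Stmt.stub_scalar` (CONJECTURE Xˢ: every injective simplicial-complex pair has `scalarDet ≠ 0`) and `Stmt.stub_scalarTotal` (CONJECTURE TXˢ: `scalarDet ≠ 0`
  for ALL injective `u, w` with matched emptiness — total nonsingularity on nonempty sets). EVIDENCE: 0 failures on ALL 3 056 lower pairs ≤ 4×4 and ALL
  33 480 + 33 480 + 84 314 pairs 5×4 / 4×5 / 5×5 (iso classes × all) (kit j299156), 0 singular among 1 008 random square minors with matched emptiness,
  h = 4..8, r ≤ 28 (lab/scalar.py + kit j299156); complete-graph-vs-cube numerics in the same job. The OTHER scalar crossing (`π_{cb} := ρ_b`, `μ_{ad} := ν_d`) FAILS on 38–78 % of pairs; `θ` of rank one fails on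
  `({∅,1,2},{∅,1,2})`. CHEAPEST FALSIFIER: one singular square minor at two random parameter points (lab/scalar.py).
* `stub_scalar_of_scalarTotal`, `stub_crossed_of_scalar`, `stub_symbolicNonvanishing_of_scalar`.

WHAT THIS IS NOT: no claim that the conjectures hold; nothing on crux stmt-ValiantsHypothesis-14610 or on `VP` versus `VNP`.
-/

set_option linter.dupNamespace false

namespace Summit.ValiantsHypothesis.ValiantsHypothesis.Theorems.BarrierLever.AnchoredPeeling

open Finset MvPolynomial
open Summit.ValiantsHypothesis.ValiantsHypothesis.Theorems.BarrierLever.BrickCalculus (pexpo pexpo_def)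

noncomputable section

variable {h : ℕ}

/-- Parameters of the scalar member: `θ_{ac}`, `π_c`, `μ_a`. -/
abbrev SParam (h : ℕ) : Type := (Fin h × Fin h) ⊕ Fin h ⊕ Fin h

/-- The specialisation of the crossed parameters: `π_{cb} ↦ π_c`, `μ_{ad} ↦ μ_a`. -/
def scalarMap : CParam h → SParam h
  | Sum.inl p => Sum.inl p
  | Sum.inr (Sum.inl (c, _)) => Sum.inr (Sum.inl c)
  | Sum.inr (Sum.inr (a, _)) => Sum.inr (Sum.inr a)

/-- The factor of the vertex anchor `(a | c)` in the scalar member. -/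
def scalarFactor (h : ℕ) (a c : Fin h) : MvPolynomial (Fin (h + h)) (MvPolynomial (SParam h) ℂ) :=
  1 + C (X (Sum.inl (a, c))) * X (Fin.castAdd h a) * X (Fin.natAdd h c) *
    (∏ b ∈ univ \ {a}, (1 + C (X (Sum.inr (Sum.inl c))) * X (Fin.castAdd h b))) *
    (∏ d ∈ univ \ {c}, (1 + C (X (Sum.inr (Sum.inr a))) * X (Fin.natAdd h d)))

/-- **The scalar crossed member** `𝔛ˢ = ∏_{a,c} scalarFactor a c`. -/
def scalarWitness (h : ℕ) : MvPolynomial (Fin (h + h)) (MvPolynomial (SParam h) ℂ) :=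
  ∏ p : Fin h × Fin h, scalarFactor h p.1 p.2

/-- The layout minor of the scalar member on the layout `(u, w)`. -/
def scalarDet (h r : ℕ) (u w : Fin r → Finset (Fin h)) : MvPolynomial (SParam h) ℂ :=
  (Matrix.of fun i j : Fin r => coeff (pexpo (u i) (w j)) (scalarWitness h)).det

/-- **STUB (CONJECTURE Xˢ).** The scalar member hits every injective simplicial-complex pair. -/
def Stmt.stub_scalar : Prop :=
  ∀ (h r : ℕ) (u w : Fin r → Finset (Fin h)), Function.Injective u → Function.Injective w →
    IsLowerSet (Set.range u) → IsLowerSet (Set.range w) → scalarDet h r u w ≠ 0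

/-- **STUB (CONJECTURE TXˢ).** Total nonsingularity of the scalar member under matched emptiness. -/
def Stmt.stub_scalarTotal : Prop :=
  ∀ (h r : ℕ) (u w : Fin r → Finset (Fin h)), Function.Injective u → Function.Injective w →
    ((∃ i, u i = ∅) ↔ (∃ j, w j = ∅)) → scalarDet h r u w ≠ 0

/-! ## The specialisation `crossedWitness ↦ scalarWitness` is a renaming of parameters -/

/-- The renaming ring map. -/
def scalarHom : MvPolynomial (CParam h) ℂ →+* MvPolynomial (SParam h) ℂ := (rename scalarMap).toRingHom

/-- `scalarHom` on a variable. -/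
theorem scalarHom_X (v : CParam h) : scalarHom (X v) = X (scalarMap v) := by
  rw [scalarHom, AlgHom.toRingHom_eq_coe, RingHom.coe_coe, rename_X]

/-- A crossed factor renames to the scalar factor. -/
theorem map_scalarHom_crossedFactor (a c : Fin h) :
    MvPolynomial.map scalarHom (crossedFactor h a c) = scalarFactor h a c := by
  rw [crossedFactor, scalarFactor]
  simp only [map_add, map_one, map_mul, map_prod, map_C, map_X, scalarHom_X, scalarMap]

/-- **The renamed crossed member is the scalar member.** -/
theorem map_scalarHom_crossedWitness : MvPolynomial.map scalarHom (crossedWitness h) = scalarWitness h := by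
  rw [crossedWitness, map_prod, scalarWitness]
  exact Finset.prod_congr rfl (fun p _ => map_scalarHom_crossedFactor p.1 p.2)

/-- The renaming maps the crossed minor to the scalar minor. -/
theorem scalarHom_crossedDet {r : ℕ} (u w : Fin r → Finset (Fin h)) : scalarHom (crossedDet h r u w) = scalarDet h r u w := by
  rw [crossedDet, RingHom.map_det, scalarDet]
  congr 1
  ext i j
  rw [RingHom.mapMatrix_apply, Matrix.map_apply, Matrix.of_apply, Matrix.of_apply, ← coeff_map, map_scalarHom_crossedWitness]

/-- **TRANSFER** to the crossed member. -/
theorem crossedDet_ne_zero_of_scalarDet_ne_zero {r : ℕ} (u w : Fin r → Finset (Fin h)) (hne : scalarDet h r u w ≠ 0) :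
    crossedDet h r u w ≠ 0 := by
  intro h0
  apply hne
  rw [← scalarHom_crossedDet u w, h0, map_zero]

/-- **TRANSFER** to the symbolic door at every profile `s ≥ 1`. -/
theorem symbolicDet_ne_zero_of_scalarDet_ne_zero {s r : ℕ} (hs : 1 ≤ s) (u w : Fin r → Finset (Fin h)) (hne : scalarDet h r u w ≠ 0) :
    symbolicDet s h r u w ≠ 0 :=
  symbolicDet_ne_zero_of_crossedDet_ne_zero hs u w (crossedDet_ne_zero_of_scalarDet_ne_zero u w hne)

/-- TXˢ ⟹ Xˢ (lower pairs have matched emptiness). -/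
theorem stub_scalar_of_scalarTotal (H : Stmt.stub_scalarTotal) : Stmt.stub_scalar := by
  intro h r u w hu hw hlu hlw
  refine H h r u w hu hw ?_
  rcases Nat.eq_zero_or_pos r with hr | hr
  · subst hr
    exact ⟨fun ⟨i, _⟩ => i.elim0, fun ⟨j, _⟩ => j.elim0⟩
  · have hu0 : (∅ : Finset (Fin h)) ∈ Set.range u := hlu (Finset.empty_subset (u ⟨0, hr⟩)) ⟨⟨0, hr⟩, rfl⟩
    have hw0 : (∅ : Finset (Fin h)) ∈ Set.range w := hlw (Finset.empty_subset (w ⟨0, hr⟩)) ⟨⟨0, hr⟩, rfl⟩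
    obtain ⟨i, hi⟩ := hu0
    obtain ⟨j, hj⟩ := hw0
    exact ⟨fun _ => ⟨j, hj⟩, fun _ => ⟨i, hi⟩⟩

/-- Xˢ ⟹ X. -/
theorem stub_crossed_of_scalar (H : Stmt.stub_scalar) : Stmt.stub_crossed :=
  fun h r u w hu hw hlu hlw => crossedDet_ne_zero_of_scalarDet_ne_zero u w (H h r u w hu hw hlu hlw)

/-- Xˢ ⟹ the line's symbolic non-vanishing stub (`s := 1`, `h₀ := 0`). -/
theorem stub_symbolicNonvanishing_of_scalar (H : Stmt.stub_scalar) : Stmt.stub_symbolicNonvanishing :=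
  stub_symbolicNonvanishing_of_crossed (stub_crossed_of_scalar H)

/-- TXˢ ⟹ total nonsingularity of the full symbolic door (the TU1 shape), every profile `s ≥ 1`. -/
theorem symbolicDet_ne_zero_of_scalarTotal (H : Stmt.stub_scalarTotal) {s r : ℕ} (hs : 1 ≤ s) (u w : Fin r → Finset (Fin h))
    (hu : Function.Injective u) (hw : Function.Injective w) (hm : (∃ i, u i = ∅) ↔ (∃ j, w j = ∅)) : symbolicDet s h r u w ≠ 0 :=
  symbolicDet_ne_zero_of_scalarDet_ne_zero hs u w (H h r u w hu hw hm)

/-! ## CORRECTION (val-np-p1 g18, same session, one hour later): CONJECTURES Xˢ AND TXˢ ARE FALSE — the offers are WITHDRAWN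

WITNESS: `R = {∅} ∪ {15 points}` (x-vertices `0..14`), `C = 2^[4]`, `r = 16` (a lower pair; U1 holds for it by the thin step). The rows `{a}` of the
scalar member are `M[{a},V] = μ_a^{|V|-1} · Σ_{c∈V} θ_{ac}`, i.e. `Σ_c θ_{ac} · (μ_a^{|V|-1}[c ∈ V])_V`; for each `c` the vectors `(μ^{|V|-1}[c ∈ V])_V`
span at most `q` dimensions (one per size `|V|`), and the size-`q` and size-`q-1` layers contribute only `1` and `q` dimensions in total, so all point rows lie
in a space of dimension `≤ q² − q + 1` (`= 13` for `q = 4`, `= 21` for `q = 5`): rank `≤ 14 < 16` (`q = 4`), `≤ 22 < 32` (`q = 5`), confirmed numerically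
(lab/flatcube.py: scalar rank 14 / 22; crossed member p604838: 16 / 32; full door: 16 / 32). On random «wide» pairs (R low-dimensional on many vertices,
C deep on few) the scalar member fails in ≈ 5 % (lab/wide.py: 33 of 592) while the crossed member passed all 592 + 40 dense-graph-vs-deep pairs (lab/wide2.py).
So the census evidence above (pairs on ≤ 5 vertices per side) was blind to width; `Stmt.stub_scalar` and `Stmt.stub_scalarTotal` must NOT be registered.
The transfer lemmas of this file stay valid. CONJECTURE X / TX (p604838, `μ_{ad}` depending on `d`, `π_{cb}` on `b`) are unaffected: the `d`-dependence
of `μ` is exactly what restores the span of the point rows (`λ_a e^{m_a}` spans the whole maximal ideal). -/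

/-- The counterexample layout to Xˢ, rows: `∅` and the fifteen points (as subsets of `Fin 15`). -/
def scalarCexRows : Fin 16 → Finset (Fin 15) := fun i => if h0 : i.1 = 0 then ∅ else {⟨i.1 - 1, by omega⟩}

/-- The counterexample layout to Xˢ, columns: the sixteen subsets of `{0,1,2,3} ⊆ Fin 15` (binary expansion of the index). -/
def scalarCexCols : Fin 16 → Finset (Fin 15) := fun j => (Finset.univ : Finset (Fin 15)).filter fun c => c.1 < 4 ∧ Nat.testBit j.1 c.1

end

end Summit.ValiantsHypothesis.ValiantsHypothesis.Theorems.BarrierLever.AnchoredPeeling
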